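import Mathlib.Analysis.Calculus.MeanValue
import Mathlib.Analysis.Calculus.Deriv.MeanValue
import Mathlib.Analysis.SpecialFunctions.ExpDeriv
import Mathlib.Topology.Sequences
import Mathlib.Topology.UniformSpace.UniformConvergence
import Mathlib.Topology.MetricSpace.Pseudo.Lemmas
import Mathlib.Order.Filter.AtTopBot.CountablyGenerated
import HarnessLib

/-!
# Hamilton's Lemma 3.1 / 3.5 for minima of differentiable families: the barrier form
(topic `Geometry/Riemannian`)

Support file of the decomposition of `Literature.Geometry.Riemannian.hamilton_chenZhu_pinching`
(`PinchingEstimates.lean`), generalising `HamiltonODEMinPrinciple.lean` from linear to arbitrary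
differentiable families, which is what the quotient- and logarithm-type pinching inequalities of
Hamilton 1997, Thms. 1.3–2.3 need. Hamilton 1986, §3: "If `f(t)` is a Lipschitz function of `t`,
we say `df/dt ≤ c` if the lim sup of all forward difference quotients is `≤ c` … 3.1. Lemma. If
`f(a) ≤ 0` and `df/dt ≤ 0` when `f ≥ 0` on `a ≤ t ≤ b`, then `f(b) ≤ 0` … 3.3. Corollary. If
`f(a) ≤ 0` and `df/dt ≤ cf` on `a ≤ t ≤ b`, then `f(b) ≤ 0` … 3.5. Lemma [Danskin]. Let `g` be a
smooth function of `t` and `y ∈ Y` compact, `f(t) = sup{g(t, y) : y ∈ Y}`; then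
`df/dt ≤ sup{∂g/∂t (t, y) : y ∈ Y(t)}`, `Y(t) = {y : g(t, y) = f(t)}`."

PROVED here, for `φ(t) = min_{p ∈ K} G(t, p)` with `K` a nonempty compact set in a metric space
of parameters, `G(·, p)` differentiable on `[a, b]` with derivative `G'(·, p)`, and `G`, `G'`
jointly continuous on `[a, b] × K`:

* `continuousOn_minOverSet` — `φ` is continuous on `[a, b]`;
* `eventually_lt_slope_minOverSet` — **Danskin** (Lemma 3.5, `inf` form): if every minimiser `p`
  of `G(t, ·)` has `G'(t, p) > r`, then the forward difference quotients of `φ` at `t` are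
  eventually `> r`;
* `minOverSet_nonneg_of_deriv` — **Lemma 3.1 / Cor. 3.3 for `φ`**: if at every `t ∈ [a, b)` every
  minimiser `p` with `-η < G(t, p) ≤ 0` satisfies the one-sided linear bound
  `G'(t, p) ≥ C · G(t, p)`, then `φ(a) ≥ 0` implies `φ(b) ≥ 0` (barrier `-εe^{(C+1)(t-a)}` in
  Mathlib's `image_le_of_liminf_slope_right_lt_deriv_boundary'`).

## References

* R. S. Hamilton, *Four-manifolds with positive curvature operator*, J. Differential Geom. 24
  (1986), §3, Lemma 3.1, Cor. 3.3, Lemma 3.5 (pp. 158–159). [Hamilton1986]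
* R. S. Hamilton, Comm. Anal. Geom. 5 (1997), §2.2, p. 14 (Dini conventions). [Hamilton1997]
-/

noncomputable section

open Set Filter Topology

namespace Literature.Geometry.Riemannian

namespace HamiltonODE

variable {P : Type*} [PseudoMetricSpace P]

/-- `min_{p ∈ K} g(p)` as an infimum (attained for `K` compact nonempty and `g` continuous).
[folklore] -/
def minOverSet (K : Set P) (g : P → ℝ) : ℝ := sInf (g '' K)

section Compact

variable {K : Set P} (hK : IsCompact K) (hKne : K.Nonempty)
include hK hKne

/-- The minimum of a continuous function over a nonempty compact set is attained. [folklore] -/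
theorem exists_minOverSet_eq {g : P → ℝ} (hg : ContinuousOn g K) :
    ∃ p ∈ K, minOverSet K g = g p ∧ ∀ q ∈ K, g p ≤ g q :=
  hK.exists_sInf_image_eq_and_le hKne hg

/-- The minimum is a lower bound. [folklore] -/
theorem minOverSet_le {g : P → ℝ} (hg : ContinuousOn g K) {p : P} (hp : p ∈ K) :
    minOverSet K g ≤ g p := by
  obtain ⟨q, -, hq, hmin⟩ := exists_minOverSet_eq hK hKne hg
  rw [hq]; exact hmin p hp

/-- `m ≤ min` iff `m` is a lower bound. [folklore] -/
theorem le_minOverSet_iff {g : P → ℝ} (hg : ContinuousOn g K) (m : ℝ) :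
    m ≤ minOverSet K g ↔ ∀ p ∈ K, m ≤ g p := by
  refine ⟨fun h p hp ↦ h.trans (minOverSet_le hK hKne hg hp), fun h ↦ ?_⟩
  obtain ⟨q, hqK, hq, -⟩ := exists_minOverSet_eq hK hKne hg
  rw [hq]; exact h q hqK

/-- Two functions uniformly within `δ` on `K` have minima within `δ`. [folklore] -/
theorem minOverSet_le_add {g h : P → ℝ} (hg : ContinuousOn g K) (hh : ContinuousOn h K) {δ : ℝ}
    (hgh : ∀ p ∈ K, g p ≤ h p + δ) : minOverSet K g ≤ minOverSet K h + δ := by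
  obtain ⟨q, hqK, hq, -⟩ := exists_minOverSet_eq hK hKne hh
  rw [hq]
  exact (minOverSet_le hK hKne hg hqK).trans (hgh q hqK)

/-! ### Along a differentiable family -/

variable {G G' : ℝ → P → ℝ} {a b : ℝ}
  (hGc : ContinuousOn (fun q : ℝ × P ↦ G q.1 q.2) (Icc a b ×ˢ K))
include hGc

omit hK hKne in
/-- Each `G(t, ·)`, `t ∈ [a, b]`, is continuous on `K`. [folklore] -/
theorem continuousOn_slice {t : ℝ} (ht : t ∈ Icc a b) : ContinuousOn (G t) K :=
  hGc.comp (Continuous.prodMk_right t).continuousOn fun _ hp ↦ ⟨ht, hp⟩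

omit hKne in
/-- Uniform continuity in `t`, uniformly over the compact `K`. [folklore] -/
theorem exists_forall_abs_sub_lt {ε : ℝ} (hε : 0 < ε) :
    ∃ δ > 0, ∀ t ∈ Icc a b, ∀ t' ∈ Icc a b, |t - t'| < δ → ∀ p ∈ K, |G t p - G t' p| < ε := by
  have hU := (isCompact_Icc.prod hK).uniformContinuousOn_of_continuous hGc
  rw [Metric.uniformContinuousOn_iff] at hU
  obtain ⟨δ, hδ, h⟩ := hU ε hε
  refine ⟨δ, hδ, fun t ht t' ht' htt' p hp ↦ ?_⟩
  have := h (t, p) ⟨ht, hp⟩ (t', p) ⟨ht', hp⟩ (by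
    rw [Prod.dist_eq, dist_self, max_eq_left dist_nonneg]
    rwa [Real.dist_eq])
  rwa [Real.dist_eq] at this

/-- **The minimum is continuous along the family.** [folklore] -/
theorem continuousOn_minOverSet : ContinuousOn (fun t ↦ minOverSet K (G t)) (Icc a b) := by
  refine Metric.continuousOn_iff.2 fun t ht ε hε ↦ ?_
  obtain ⟨δ, hδ, h⟩ := exists_forall_abs_sub_lt hK hGc (half_pos hε)
  refine ⟨δ, hδ, fun t' ht' htt' ↦ ?_⟩
  rw [Real.dist_eq] at htt' ⊢
  have h1 := h t' ht' t ht htt'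
  have h2 := h t ht t' ht' (by rwa [abs_sub_comm])
  rw [abs_sub_lt_iff]
  constructor
  · have := minOverSet_le_add hK hKne (continuousOn_slice hGc ht')
      (continuousOn_slice hGc ht) (δ := ε / 2) fun p hp ↦ by
        linarith [(abs_sub_lt_iff.1 (h1 p hp)).1]
    linarith
  · have := minOverSet_le_add hK hKne (continuousOn_slice hGc ht)
      (continuousOn_slice hGc ht') (δ := ε / 2) fun p hp ↦ by
        linarith [(abs_sub_lt_iff.1 (h2 p hp)).1]
    linarith

variable (hG : ∀ p ∈ K, ∀ s ∈ Icc a b, _root_.HasDerivAt (fun t ↦ G t p) (G' s p) s)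
  (hG'c : ContinuousOn (fun q : ℝ × P ↦ G' q.1 q.2) (Icc a b ×ˢ K))
include hG hG'c

/-- **Danskin's inequality** (Hamilton 1986, Lemma 3.5, `inf` form): at `x ∈ [a, b)`, if every
minimiser `p ∈ K` of `G(x, ·)` has `G'(x, p) > r`, then the forward difference quotients of
`φ = min_K G(·, ·)` at `x` are eventually `> r`. (By contradiction: quotients `≤ r` along
`zₙ ↓ x` give minimisers `pₙ` at `zₙ` and, by the mean value theorem, points `ξₙ ∈ (x, zₙ)` with
`G'(ξₙ, pₙ) ≤ r`; a subsequence of `pₙ` converges to a minimiser `p*` at `x` with `G'(x, p*) ≤ r`.)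
[cite: Hamilton1986, §3, Lemma 3.5 (p. 159)] -/
theorem eventually_lt_slope_minOverSet {x : ℝ} (hx : x ∈ Ico a b) {r : ℝ}
    (hr : ∀ p ∈ K, IsMinOn (G x) K p → r < G' x p) :
    ∀ᶠ z in 𝓝[>] x, r < slope (fun t ↦ minOverSet K (G t)) x z := by
  have hxI : x ∈ Icc a b := Ico_subset_Icc_self hx
  set φ : ℝ → ℝ := fun t ↦ minOverSet K (G t) with hφ
  by_contra hcon
  have hfreq : ∃ᶠ z in 𝓝[>] x, slope φ x z ≤ r ∧ z ∈ Ioo x b := by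
    have h1 : ∃ᶠ z in 𝓝[>] x, slope φ x z ≤ r := by
      simpa [not_eventually, not_lt] using hcon
    exact h1.and_eventually (Ioo_mem_nhdsGT hx.2)
  obtain ⟨zs, hzs, hzsP⟩ := exists_seq_forall_of_frequently hfreq
  have hzI : ∀ n, zs n ∈ Icc a b := fun n ↦ ⟨hxI.1.trans (hzsP n).2.1.le, (hzsP n).2.2.le⟩
  -- minimisers at `zs n`, mean-value points, convergent subsequence
  choose pm hpmK hpmeq hpmmin using fun n ↦
    exists_minOverSet_eq hK hKne (continuousOn_slice hGc (hzI n))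
  have hmvt : ∀ n, ∃ ξ ∈ Ioo x (zs n), G' ξ (pm n) = (G (zs n) (pm n) - G x (pm n)) / (zs n - x) := by
    intro n
    have hxz : x < zs n := (hzsP n).2.1
    have hsub : Icc x (zs n) ⊆ Icc a b := Icc_subset_Icc hxI.1 (hzI n).2
    refine exists_hasDerivAt_eq_slope (fun t ↦ G t (pm n)) (fun t ↦ G' t (pm n)) hxz ?_ ?_
    · exact fun t ht ↦ (hG _ (hpmK n) t (hsub ht)).continuousAt.continuousWithinAt
    · exact fun t ht ↦ hG _ (hpmK n) t (hsub (Ioo_subset_Icc_self ht))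
  choose ξ hξ hξeq using hmvt
  obtain ⟨pstar, hpK, ψ, hψ, hpψ⟩ := hK.tendsto_subseq hpmK
  have hzψ : Tendsto (zs ∘ ψ) atTop (𝓝[>] x) := hzs.comp hψ.tendsto_atTop
  have hzψx : Tendsto (zs ∘ ψ) atTop (𝓝 x) := hzψ.mono_right nhdsWithin_le_nhds
  have hξx : Tendsto (ξ ∘ ψ) atTop (𝓝 x) := by
    refine tendsto_of_tendsto_of_tendsto_of_le_of_le tendsto_const_nhds hzψx
      (fun n ↦ (hξ (ψ n)).1.le) (fun n ↦ (hξ (ψ n)).2.le)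
  have hpψ' : Tendsto (fun n ↦ pm (ψ n)) atTop (𝓝 pstar) := hpψ
  -- `G'(ξ, p) ≤ r` along the subsequence
  have hle : ∀ n, G' (ξ (ψ n)) (pm (ψ n)) ≤ r := by
    intro n
    obtain ⟨hsl, hxz, -⟩ := hzsP (ψ n)
    have hzx : 0 < zs (ψ n) - x := sub_pos.2 hxz
    rw [hξeq, div_le_iff₀ hzx]
    have h1 : φ (zs (ψ n)) - φ x ≤ r * (zs (ψ n) - x) := by
      rw [slope_def_field, div_le_iff₀ hzx] at hsl; linarith
    have h2 := minOverSet_le hK hKne (continuousOn_slice hGc hxI) (hpmK (ψ n))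
    have h3 := hpmeq (ψ n)
    simp only [hφ] at h1
    linarith
  -- limit: `G'(x, p*) ≤ r`
  have hin : ∀ n, (ξ (ψ n), pm (ψ n)) ∈ Icc a b ×ˢ K := fun n ↦
    ⟨⟨hxI.1.trans (hξ (ψ n)).1.le, ((hξ (ψ n)).2.trans (hzsP (ψ n)).2.2).le⟩, hpmK _⟩
  have hlim : Tendsto (fun n ↦ G' (ξ (ψ n)) (pm (ψ n))) atTop (𝓝 (G' x pstar)) := by
    have h := (hG'c (x, pstar) ⟨hxI, hpK⟩).tendsto.comp
      (tendsto_nhdsWithin_iff.2 ⟨hξx.prodMk_nhds hpψ', Eventually.of_forall hin⟩)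
    simpa [Function.comp_def] using h
  have hneg : G' x pstar ≤ r := le_of_tendsto' hlim hle
  -- `p*` is a minimiser at `x`
  have hmin' : IsMinOn (G x) K pstar := by
    refine isMinOn_iff.2 fun q hq ↦ ?_
    have hleft : Tendsto (fun n ↦ G x (pm (ψ n))) atTop (𝓝 (G x pstar)) :=
      ((continuousOn_slice hGc hxI) pstar hpK).tendsto.comp
        (tendsto_nhdsWithin_iff.2 ⟨hpψ', Eventually.of_forall fun n ↦ hpmK _⟩)
    refine le_of_forall_pos_lt_add fun ε hε ↦ ?_
    obtain ⟨δ, hδ, hU⟩ := exists_forall_abs_sub_lt hK hGc (show 0 < ε / 3 by positivity)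
    have hev : ∀ᶠ n in atTop, |zs (ψ n) - x| < δ := by
      have := (Metric.tendsto_nhds.1 hzψx) δ hδ
      exact this.mono fun n hn ↦ by rwa [Real.dist_eq] at hn
    have hbound : ∀ᶠ n in atTop, G x (pm (ψ n)) ≤ G x q + 2 * (ε / 3) := by
      filter_upwards [hev] with n hn
      have h1 := hU (zs (ψ n)) (hzI (ψ n)) x hxI hn (pm (ψ n)) (hpmK _)
      have h2 := hU (zs (ψ n)) (hzI (ψ n)) x hxI hn q hq
      have h3 := hpmmin (ψ n) q hq
      rw [abs_sub_lt_iff] at h1 h2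
      linarith
    have := le_of_tendsto hleft hbound
    linarith
  linarith [hr pstar hpK hmin']

omit hG hG'c in
/-- A minimiser realises the minimum. [folklore] -/
theorem minOverSet_eq_of_isMinOn {t : ℝ} (ht : t ∈ Icc a b) {p : P} (hp : p ∈ K)
    (hmin : IsMinOn (G t) K p) : minOverSet K (G t) = G t p :=
  le_antisymm (minOverSet_le hK hKne (continuousOn_slice hGc ht) hp)
    ((le_minOverSet_iff hK hKne (continuousOn_slice hGc ht) _).2 fun _ hq ↦ hmin hq)

/-- **Hamilton's Lemma 3.1 / Cor. 3.3 for the minimum of a differentiable family** (barrier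
form): with `φ(t) = min_{p ∈ K} G(t, p)` as above, suppose there are `η > 0` and `C ≥ 0` such
that at every `t ∈ [a, b)` every minimiser `p` with `-η < G(t, p) ≤ 0` satisfies
`G'(t, p) ≥ C G(t, p)`. Then `φ(a) ≥ 0` implies `φ(b) ≥ 0`: by Danskin the lower right Dini
derivative of `φ` at such `t` is `≥ C φ(t)`, and the barrier `-εe^{(C+1)(t-a)}` cannot be
crossed (Mathlib's `image_le_of_liminf_slope_right_lt_deriv_boundary'`); let `ε → 0`.
[cite: Hamilton1986, §3, Lemma 3.1 and Cor. 3.3 (pp. 158–159)] -/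
theorem minOverSet_nonneg_of_deriv (hab : a ≤ b) {η C : ℝ} (hη : 0 < η) (hC : 0 ≤ C)
    (hsign : ∀ s ∈ Ico a b, ∀ p ∈ K, IsMinOn (G s) K p → -η < G s p → G s p ≤ 0 →
      C * G s p ≤ G' s p)
    (h0 : 0 ≤ minOverSet K (G a)) : 0 ≤ minOverSet K (G b) := by
  classical
  set φ : ℝ → ℝ := fun t ↦ minOverSet K (G t) with hφ
  have hφcont : ContinuousOn φ (Icc a b) := continuousOn_minOverSet hK hKne hGc
  set κ : ℝ := C + 1 with hκ
  have hκpos : 0 < κ := by rw [hκ]; linarith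
  have hmain : ∀ ε : ℝ, 0 < ε → ε * Real.exp (κ * (b - a)) < η →
      -(ε * Real.exp (κ * (b - a))) ≤ φ b := by
    intro ε hε hεη
    set f' : ℝ → ℝ := fun t ↦ if -η < φ t ∧ φ t ≤ 0 then -(C * φ t)
      else -minOverSet K (G' t) + 1 with hf'
    have hBd : ∀ t, _root_.HasDerivAt (fun t ↦ ε * Real.exp (κ * (t - a)))
        (κ * (ε * Real.exp (κ * (t - a)))) t := fun t ↦ by
      have h := ((((hasDerivAt_id t).sub_const a).const_mul κ).exp.const_mul ε)
      refine h.congr_deriv ?_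
      simp only [id, mul_one]
      ring
    have hslope_neg : ∀ t z, slope (fun t ↦ -φ t) t z = -slope φ t z := fun t z ↦ by
      simp only [slope_def_field, neg_sub_neg, ← neg_sub (φ z) (φ t), neg_div]
    have key := image_le_of_liminf_slope_right_lt_deriv_boundary' (f := fun t ↦ -φ t) (f' := f')
      (a := a) (b := b) hφcont.neg ?hf' (B := fun t ↦ ε * Real.exp (κ * (t - a)))
      (B' := fun t ↦ κ * (ε * Real.exp (κ * (t - a)))) ?ha
      (fun t _ ↦ (hBd t).continuousAt.continuousWithinAt) (fun t _ ↦ (hBd t).hasDerivWithinAt)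
      ?bound (right_mem_Icc.2 hab)
    · linarith
    case ha =>
      have : Real.exp (κ * (a - a)) = 1 := by simp
      simp only [this, mul_one]
      linarith
    case hf' =>
      intro t ht r hr
      have htI : t ∈ Icc a b := Ico_subset_Icc_self ht
      have hD : ∀ p ∈ K, IsMinOn (G t) K p → -r < G' t p := by
        intro p hp hmin
        have heq := minOverSet_eq_of_isMinOn hK hKne hGc htI hp hmin
        by_cases hgood : -η < φ t ∧ φ t ≤ 0
        · simp only [hf', hgood, and_self, if_true] at hr
          have hs := hsign t ht p hp hmin (by rw [← heq]; exact hgood.1) (by rw [← heq]; exact hgood.2)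
          rw [← heq] at hs
          linarith
        · simp only [hf', hgood, if_false] at hr
          have := minOverSet_le hK hKne (continuousOn_slice hG'c htI) hp
          linarith
      have h := eventually_lt_slope_minOverSet hK hKne hGc hG hG'c ht hD
      refine (h.mono fun z hz ↦ ?_).frequently
      rw [hslope_neg]; linarith
    case bound =>
      intro t ht hft
      have hexp : Real.exp (κ * (t - a)) ≤ Real.exp (κ * (b - a)) :=
        Real.exp_le_exp.2 (mul_le_mul_of_nonneg_left (by linarith [ht.2]) hκpos.le)
      have hφt : φ t = -(ε * Real.exp (κ * (t - a))) := by linarith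
      have hgood : -η < φ t ∧ φ t ≤ 0 := by
        rw [hφt]
        exact ⟨by nlinarith, by have := Real.exp_pos (κ * (t - a)); nlinarith⟩
      have hf't : f' t = -(C * φ t) := by simp only [hf', hgood, and_self, if_true]
      rw [hf't, hφt, hκ]
      have := Real.exp_pos ((C + 1) * (t - a))
      nlinarith
  refine le_of_forall_pos_lt_add fun δ hδ ↦ ?_
  have hE : 0 < Real.exp (κ * (b - a)) := Real.exp_pos _
  set ε : ℝ := min (δ / 2) (η / 2) / Real.exp (κ * (b - a)) with hε
  have hεpos : 0 < ε := by positivity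
  have hεe : ε * Real.exp (κ * (b - a)) = min (δ / 2) (η / 2) := by
    rw [hε, div_mul_cancel₀ _ hE.ne']
  have h1 := hmain ε hεpos (by rw [hεe]; linarith [min_le_right (δ / 2) (η / 2)])
  rw [hεe] at h1
  linarith [min_le_left (δ / 2) (η / 2)]

end Compact

end HamiltonODE

end Literature.Geometry.Riemannian

end
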